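import Literature.AlgebraicGeometry.ShimuraVarieties.UnitaryBallQuotientDatum
import HarnessLib

/-!
# Hermitian Gram matrices under an involution: the transposed form `Hᵀ = σ(H)` and entrywise-conjugated congruence subgroups

Pure algebra behind the complex conjugate of a compact arithmetic ball quotient
(`ShimuraVarieties/UnitaryBallConjugateDatum.lean`).  For a commutative ring `R` with an INVOLUTION
`σ` (a CM field with its complex conjugation) and a Gram matrix `H` (hermitian: `σ(H) = Hᵀ`):

* `hermForm_transpose` — `⟪u, v⟫_{Hᵀ} = ⟪σv, σu⟫_H`: the form of `Hᵀ` is the `σ`-twist of the form of `H`;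
* `map_mem_unitaryGroup_transpose` — entrywise `σ` carries `U(H)` into `U(Hᵀ)`;
* `IsCongruentOneMod.map` — `g ≡ 1 (mod n)` integrally ⟹ `σ(g) ≡ 1 (mod n)` (a ring endomorphism of a
  number field preserves the ring of integers); `map_principalCongruenceSubgroup_transpose` — entrywise
  `σ` carries the principal congruence subgroup of `U(H)` ONTO that of `U(Hᵀ)`;
  `IsCongruenceSubgroup.map_transpose` — hence congruence subgroups to congruence subgroups (same level,
  same index: `GLₙ(σ)` is injective); `torsionFree_map` — and torsion-free ones to torsion-free ones;
* over `ℂ`: `map_conj_mulVec` (`σ(M)·v = \overline{M·v̄}`), `mem_negCone_transpose_iff`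
  (`v ∈ negCone Hcᵀ ↔ v̄ ∈ negCone Hc`), `IsHermitian.transpose_eq_map_conj`, and the signature transport
  `exists_conjTranspose_mul_transpose_mul` (`Tᴴ A T = S`, `Sᵀ = S` ⟹ `T̄ᴴ Aᵀ T̄ = S`).

All statements are elementary matrix algebra (Bergeron–Millson–Moeglin, Part 2 §§1.1–1.2 for the
objects); everything is proved.

## References

* [BergeronMillsonMoeglin2016Balls] N. Bergeron, J. Millson, C. Moeglin, Acta Math. 216 (2016), Introduction §1.1, Part 2 §§1.1–1.3.
-/

noncomputable section

open Matrix NumberField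
open scoped ComplexOrder ComplexConjugate

namespace Literature.AlgebraicGeometry.ShimuraVarieties

/-! ### Algebra: the transposed Gram matrix and entrywise-conjugated groups -/

section Algebra

variable {R : Type*} [CommRing R] {m : Type*} [Fintype m]

/-- For an involution `σ`, the form with Gram matrix `Hᵀ = σ(H)` is the `σ`-twist of the form of `H`:
`⟪u, v⟫_{Hᵀ} = ⟪σv, σu⟫_H`. [cite: BergeronMillsonMoeglin2016Balls, Part 2 §1.1] -/
theorem hermForm_transpose {σ : R →+* R} (hσ : ∀ x, σ (σ x) = x) (H : Matrix m m R) (u v : m → R) :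
    hermForm σ Hᵀ u v = hermForm σ H (σ ∘ v) (σ ∘ u) := by
  have h2 : σ ∘ (σ ∘ v) = v := funext fun i => hσ (v i)
  show (σ ∘ u) ⬝ᵥ (Hᵀ *ᵥ v) = (σ ∘ (σ ∘ v)) ⬝ᵥ (H *ᵥ (σ ∘ u))
  rw [h2, mulVec_transpose, dotProduct_comm, dotProduct_mulVec]

variable [DecidableEq m]

/-- The matrix of `GLₙ(f) g` is the entrywise image `g.map f`. [folklore] -/
private theorem coe_generalLinearGroup_map {S : Type*} [CommRing S] (f : R →+* S) (g : GL m R) :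
    ((Matrix.GeneralLinearGroup.map f g : GL m S) : Matrix m m S) = (g : Matrix m m R).map f := rfl

/-- For an involution `σ`, `GLₙ(σ)` is an involution. [folklore] -/
private theorem generalLinearGroup_map_map {σ : R →+* R} (hσ : ∀ x, σ (σ x) = x) (g : GL m R) :
    Matrix.GeneralLinearGroup.map σ (Matrix.GeneralLinearGroup.map σ g) = g := by
  ext i j
  simp only [Matrix.GeneralLinearGroup.map_apply, hσ]

/-- For an involution `σ`, `GLₙ(σ)` is injective. [folklore] -/
private theorem generalLinearGroup_map_injective {σ : R →+* R} (hσ : ∀ x, σ (σ x) = x) :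
    Function.Injective (Matrix.GeneralLinearGroup.map (n := m) σ) :=
  Function.LeftInverse.injective (generalLinearGroup_map_map hσ)

/-- **Entrywise conjugation carries `U(H)` into `U(Hᵀ)`**: if `(σg)ᵀ H g = H` then
`(σ(σg))ᵀ Hᵀ (σg) = gᵀ Hᵀ σg = ((σg)ᵀ H g)ᵀ = Hᵀ`. [cite: BergeronMillsonMoeglin2016Balls, Part 2 §1.2] -/
theorem map_mem_unitaryGroup_transpose {σ : R →+* R} (hσ : ∀ x, σ (σ x) = x) {H : Matrix m m R}
    {g : GL m R} (hg : g ∈ unitaryGroup σ H) :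
    Matrix.GeneralLinearGroup.map σ g ∈ unitaryGroup σ Hᵀ := by
  rw [mem_unitaryGroup_iff] at hg ⊢
  have hmm : ((g : Matrix m m R).map σ).map σ = g := by
    ext i j
    simp only [Matrix.map_apply, hσ]
  rw [coe_generalLinearGroup_map, hmm]
  have key := congrArg Matrix.transpose hg
  rw [transpose_mul, transpose_mul, transpose_transpose, ← Matrix.mul_assoc] at key
  exact key

variable {E : Type*} [Field E]

/-- Membership in the principal congruence subgroup (definitional unfolding). [folklore] -/
private theorem mem_principalCongruence_iff_aux {σ : E →+* E} {H : Matrix m m E} {n : ℕ} {g : GL m E} :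
    g ∈ principalCongruenceSubgroup σ H n ↔ g ∈ unitaryGroup σ H ∧
      IsCongruentOneMod n (g : Matrix m m E) ∧ IsCongruentOneMod n ((g⁻¹ : GL m E) : Matrix m m E) :=
  Iff.rfl

/-- A ring endomorphism of a number field preserves integrality, hence `g ≡ 1 (mod n)` integrally
implies `σ(g) ≡ 1 (mod n)`. [folklore] -/
private theorem IsCongruentOneMod.map (σ : E →+* E) {n : ℕ} {g : Matrix m m E} (hg : IsCongruentOneMod n g) :
    IsCongruentOneMod n (g.map σ) := by
  obtain ⟨A, rfl⟩ := hg
  refine ⟨A.map (RingOfIntegers.mapRingHom σ), ?_⟩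
  change σ.mapMatrix (1 + n • A.map (algebraMap (𝓞 E) E)) = _
  rw [map_add, map_one, map_nsmul]
  congr 1

/-- **Entrywise conjugation by an involution `σ` carries the principal congruence subgroup of `U(H)`
ONTO that of `U(Hᵀ)`** (same level `n`). [cite: BergeronMillsonMoeglin2016Balls, Introduction §1.1] -/
theorem map_principalCongruenceSubgroup_transpose {σ : E →+* E} (hσ : ∀ x, σ (σ x) = x)
    (H : Matrix m m E) (n : ℕ) :
    (principalCongruenceSubgroup σ H n).map (Matrix.GeneralLinearGroup.map σ) =
      principalCongruenceSubgroup σ Hᵀ n := by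
  ext g'
  constructor
  · rintro ⟨g, hg, rfl⟩
    rw [SetLike.mem_coe, mem_principalCongruence_iff_aux] at hg
    refine ⟨map_mem_unitaryGroup_transpose hσ hg.1, hg.2.1.map σ, ?_⟩
    rw [← map_inv]
    exact hg.2.2.map σ
  · intro hg'
    refine ⟨Matrix.GeneralLinearGroup.map σ g', ?_, generalLinearGroup_map_map hσ g'⟩
    rw [mem_principalCongruence_iff_aux] at hg'
    rw [SetLike.mem_coe, mem_principalCongruence_iff_aux]
    refine ⟨?_, hg'.2.1.map σ, ?_⟩
    · have h := map_mem_unitaryGroup_transpose hσ hg'.1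
      rwa [transpose_transpose] at h
    · rw [← map_inv]
      exact hg'.2.2.map σ

/-- **Entrywise conjugation by an involution carries congruence subgroups of `U(H)` to congruence
subgroups of `U(Hᵀ)`** (same principal level, same index: `GLₙ(σ)` is injective).
[cite: BergeronMillsonMoeglin2016Balls, Introduction §1.1] -/
theorem IsCongruenceSubgroup.map_transpose {σ : E →+* E} (hσ : ∀ x, σ (σ x) = x) {H : Matrix m m E}
    {Γ : Subgroup (GL m E)} (hΓ : IsCongruenceSubgroup σ H Γ) :
    IsCongruenceSubgroup σ Hᵀ (Γ.map (Matrix.GeneralLinearGroup.map σ)) := by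
  obtain ⟨hU, n, hn, hle, hfi⟩ := hΓ
  refine ⟨?_, n, hn, ?_, ?_⟩
  · rintro _ ⟨g, hg, rfl⟩
    exact map_mem_unitaryGroup_transpose hσ (hU hg)
  · rw [← map_principalCongruenceSubgroup_transpose hσ]
    exact Subgroup.map_mono hle
  · rw [← map_principalCongruenceSubgroup_transpose hσ]
    constructor
    change Subgroup.relIndex _ _ ≠ 0
    rw [Subgroup.relIndex_map_map_of_injective _ _ (generalLinearGroup_map_injective hσ)]
    exact hfi.index_ne_zero

/-- Entrywise conjugation preserves torsion-freeness (it is an injective homomorphism; BMM take `Γ`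
torsion-free via a neat `K`). [cite: BergeronMillsonMoeglin2016Balls, Part 2 §1.4] -/
theorem torsionFree_map {σ : E →+* E} (hσ : ∀ x, σ (σ x) = x) {Γ : Subgroup (GL m E)}
    (h : ∀ γ ∈ Γ, IsOfFinOrder γ → γ = 1) :
    ∀ γ ∈ Γ.map (Matrix.GeneralLinearGroup.map σ), IsOfFinOrder γ → γ = 1 := by
  rintro _ ⟨γ, hγ, rfl⟩ hfin
  have hγfin : IsOfFinOrder γ := by
    have h2 := (Matrix.GeneralLinearGroup.map σ).isOfFinOrder hfin
    rwa [generalLinearGroup_map_map hσ] at h2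
  rw [h γ hγ hγfin, map_one]

end Algebra

/-! ### Complex linear algebra: conjugating matrices, vectors, the cone and the signature -/

section Complex

variable {m : Type*} [Fintype m]

/-- `σ(M) · v = \overline{M · v̄}` for entrywise complex conjugation. [cite: BergeronMillsonMoeglin2016Balls, Part 2 §1.2] -/
theorem map_conj_mulVec (M : Matrix m m ℂ) (v : m → ℂ) :
    (M.map (starRingEnd ℂ)) *ᵥ v = star (M *ᵥ star v) := by
  ext i
  simp only [mulVec, dotProduct, Matrix.map_apply, Pi.star_apply, star_sum, star_mul',
    Complex.star_def, Complex.conj_conj]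

/-- `star ⁻¹' negCone Hc = negCone Hcᵀ`: `v̄` is `H`-negative iff `v` is `Hᵀ`-negative
(`⟪v,v⟫_{Hᵀ} = ⟪v̄,v̄⟫_H`). [cite: BergeronMillsonMoeglin2016Balls, Part 2 §1.3] -/
theorem mem_negCone_transpose_iff {Hc : Matrix m m ℂ} {v : m → ℂ} :
    v ∈ negCone Hcᵀ ↔ star v ∈ negCone Hc := by
  simp only [negCone, Set.mem_setOf_eq]
  rw [hermForm_transpose Complex.conj_conj]
  rfl

variable [DecidableEq m]

omit [Fintype m] [DecidableEq m] in
/-- A hermitian complex matrix has transpose equal to its entrywise conjugate. [cite: BergeronMillsonMoeglin2016Balls, Part 2 §1.1] -/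
theorem IsHermitian.transpose_eq_map_conj {Hc : Matrix m m ℂ} (h : Hc.IsHermitian) :
    Hcᵀ = Hc.map (starRingEnd ℂ) := by
  ext i j
  rw [transpose_apply, Matrix.map_apply, ← h.apply i j, starRingEnd_apply, star_star]

/-- Congruence to a real diagonal target passes to the transpose via `T ↦ T̄`:
`Tᴴ A T = S`, `Sᵀ = S` ⟹ `T̄ᴴ Aᵀ T̄ = S`. [cite: BergeronMillsonMoeglin2016Balls, Part 2 §1.1] -/
theorem exists_conjTranspose_mul_transpose_mul {n : ℕ} {A S : Matrix (Fin n) (Fin n) ℂ} (hS : Sᵀ = S)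
    (T : GL (Fin n) ℂ) (h : (T : Matrix (Fin n) (Fin n) ℂ)ᴴ * A * (T : Matrix (Fin n) (Fin n) ℂ) = S) :
    ∃ T' : GL (Fin n) ℂ, (T' : Matrix (Fin n) (Fin n) ℂ)ᴴ * Aᵀ * (T' : Matrix (Fin n) (Fin n) ℂ) = S := by
  refine ⟨Matrix.GeneralLinearGroup.map (starRingEnd ℂ) T, ?_⟩
  have hT' : ((Matrix.GeneralLinearGroup.map (starRingEnd ℂ) T : GL (Fin n) ℂ) : Matrix (Fin n) (Fin n) ℂ) =
      (T : Matrix (Fin n) (Fin n) ℂ)ᵀᴴ := by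
    ext i j
    rfl
  have key := congrArg Matrix.transpose h
  rw [Matrix.transpose_mul, Matrix.transpose_mul, hS, ← Matrix.mul_assoc] at key
  rw [hT', Matrix.conjTranspose_conjTranspose]
  exact key

/-- The Sylvester matrix `diag(1,…,1,-1)` is symmetric. [cite: BergeronMillsonMoeglin2016Balls, Part 2 §1.1] -/
theorem signatureMatrix_transpose (p : ℕ) : (signatureMatrix p)ᵀ = signatureMatrix p :=
  Matrix.diagonal_transpose _

end Complex

end Literature.AlgebraicGeometry.ShimuraVarieties

end
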